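import Summits.CriticalPhenomena.PercolationContinuityZ3.Theorems.PercNearOneGluingNoHeavyLowerTailRKNS2
import HarnessLib

/-!
# `NoHeavyLowerTail` (stmt-CriticalPhenomena-4575) — the FULLY-REFINED Kozma–Nitzan residual `(RKNS³)_k`:
# the plus step with the attachment event `{o ↔ S ∪ {c}}`; `(RKNS³)_k ⟹ EG_k`; `(∀ graphs, (RKNS³) at a worst relay) ⟹ NoHeavyLowerTail`

Support file (new-inequality factory seat `prim-ineq-gen-7`, `--supports stmt-CriticalPhenomena-4575`). No definitions, no sorries.

Setting as in `…NoHeavyLowerTailRKNS2`: `μ = prodBernoulli w` on `Fin n`, relays `A`, observer `o ∉ A`, sink `c ∉ A`, `o ≠ c`, designated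
`z ∈ A`; for `∅ ≠ S ⊆ A ∖ {z}`, `R = A ∖ S`, `N'_S = {S ∪ {o} ↮ R}`, `N⁺_S = {S ∪ {o,c} ↮ R}`, `N⁻_S = {S ∪ {o} ↮ R ∪ {c}}`,
`m_S = μ(N'_S ∩ {c ↔ all S})`, `m_R = μ(N'_S ∩ {c ↔ all R})`, `Z = μ(o ↮ A, z ↮ c)`.
The exchange term is `T_S − U_S` with `T_S = μ(N'_S ∩ {o ↔ S} ∩ {c ↔ all S})`.  On `N⁺_S ∩ {c ↔ all S}` the events `{o ↔ S}` and
`{o ↔ S ∪ {c}}` coincide (`RKNS3.plus_event_eq`), and `{o ↔ S ∪ {c}}` is still increasing and read off the cluster of `S ∪ {o, c}`; so BHK Thm 1.3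
gives the plus bound with the LARGER attachment probability `A⁺⁺_S / P⁺_S`, `A⁺⁺_S = μ(N⁺_S ∩ {o ↔ S ∪ {c}}) ≥ A⁺_S`:
row `(RKNS³)_k :  Z + Σ_S [(A⁺⁺_S/P⁺_S) m_S − (A⁻_S/P⁻_S) m_R] ≥ 0`  (`≥ (RKNS²)_k ≥ (RKNS)_k` termwise, hence the WEAKEST of the three typed hypotheses).
`eventGluing_of_rkns3_at`: the row gives `μ({o↔A} ∖ {o↔c}) ≤ μ(z ↮ c)`; `noHeavyLowerTail_of_rkns3`: the row at a worst relay on every graph closes the crux.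
Why (seat census, memo run/shared/lean/prim/prim-ineq-gen-7/FINDING-RKNSK.md): on the b-star family (o ≡ c, relays pendant to c), where (RKNS)_k and
(RKNS²)_k keep only the fraction `1 − (1−q²)^{k−1} + (1−q)^{k−1} → 0⁺` of the event-gluing margin, (RKNS³)_k is EXACTLY tight (ratio 1).
[cite: KozmaNitzan2024, Theorem 2 (§3.1, pp. 8–9); VandenbergHaggstromKahn2005, Thms. 1.3–1.4 (pp. 6–7)]
-/

namespace Summit.CriticalPhenomena.PercolationContinuityZ3.Theorems

open MeasureTheory Set Literature.Probability.LatticeModels Literature.Probability.Percolation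

noncomputable section
open Classical

variable {n : ℕ}

namespace RKNS3

/-- **BHK 2006 Thm. 1.3 for the cluster of the set `S`, any-reach event of a sub-set `O₁ ⊆ S` and all-reach event of a sub-set
`O₂ ⊆ S`** (hypothesis `hB1` = first half of `stub_bhkSets`): with `D = {S ↮ X}`,
`μ(D ∩ {O₁ ↔ o}) μ(D ∩ ⋂_{O₂} {s ↔ b}) ≤ μ(D) μ(D ∩ {O₁ ↔ o} ∩ ⋂_{O₂} {s ↔ b})`. [cite: VandenbergHaggstromKahn2005, Thm. 1.3 (p. 6)] -/
theorem bhkOne_two_subsets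
    (hB1 : ∀ (n : ℕ) (w : Sym2 (Fin n) → unitInterval) (S : Finset (Fin n)) (X : Set (Fin n))
        (F G : Set (Sym2 (Fin n)) → ℝ), Monotone F → Monotone G → (∀ s ∈ S, s ∉ X) →
        (∫ ω in {ω : BondConfig (Fin n) | ∀ s ∈ S, ∀ x ∈ X, ¬ (openGraph ω).Reachable s x},
            F (⋃ s ∈ S, openEdgeCluster ω s) ∂(prodBernoulli w)) *
          (∫ ω in {ω : BondConfig (Fin n) | ∀ s ∈ S, ∀ x ∈ X, ¬ (openGraph ω).Reachable s x},
            G (⋃ s ∈ S, openEdgeCluster ω s) ∂(prodBernoulli w)) ≤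
        (prodBernoulli w).real
            {ω : BondConfig (Fin n) | ∀ s ∈ S, ∀ x ∈ X, ¬ (openGraph ω).Reachable s x} *
          ∫ ω in {ω : BondConfig (Fin n) | ∀ s ∈ S, ∀ x ∈ X, ¬ (openGraph ω).Reachable s x},
            F (⋃ s ∈ S, openEdgeCluster ω s) * G (⋃ s ∈ S, openEdgeCluster ω s)
              ∂(prodBernoulli w))
    (w : Sym2 (Fin n) → unitInterval) (S O₁ O₂ : Finset (Fin n)) (h₁ : O₁ ⊆ S) (h₂ : O₂ ⊆ S) (X : Set (Fin n)) (o b : Fin n)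
    (hSX : ∀ s ∈ S, s ∉ X) :
    (prodBernoulli w).real
          ({ω : BondConfig (Fin n) | ∀ s ∈ S, ∀ x ∈ X, ¬ (openGraph ω).Reachable s x} ∩
            ⋃ s ∈ O₁, openConn s o) *
        (prodBernoulli w).real
          ({ω : BondConfig (Fin n) | ∀ s ∈ S, ∀ x ∈ X, ¬ (openGraph ω).Reachable s x} ∩
            ⋂ s ∈ O₂, openConn s b) ≤
      (prodBernoulli w).real
          {ω : BondConfig (Fin n) | ∀ s ∈ S, ∀ x ∈ X, ¬ (openGraph ω).Reachable s x} *
        (prodBernoulli w).real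
          ({ω : BondConfig (Fin n) | ∀ s ∈ S, ∀ x ∈ X, ¬ (openGraph ω).Reachable s x} ∩
            ((⋃ s ∈ O₁, openConn s o) ∩ ⋂ s ∈ O₂, openConn s b)) := by
  have key := hB1 n w S X
    ({C : Set (Sym2 (Fin n)) | ∃ s ∈ O₁, (openGraph C).Reachable s o}.indicator 1)
    ({C : Set (Sym2 (Fin n)) | ∀ s ∈ O₂, (openGraph C).Reachable s b}.indicator 1)
    (knThm2_monotone_anyReach O₁ o) (knThm2_monotone_allReach O₂ b) hSX
  simp only [knRef_anyReach_apply_sub S O₁ h₁, knRef_allReach_apply_sub S O₂ h₂] at key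
  have h := knThm2_setIntegral_indicator w
    {ω : BondConfig (Fin n) | ∀ s ∈ S, ∀ x ∈ X, ¬ (openGraph ω).Reachable s x}
    (⋃ s ∈ O₁, openConn s o) (⋂ s ∈ O₂, openConn s b)
  have h' := knThm2_setIntegral_indicator w
    {ω : BondConfig (Fin n) | ∀ s ∈ S, ∀ x ∈ X, ¬ (openGraph ω).Reachable s x}
    (⋂ s ∈ O₂, openConn s b) (⋂ s ∈ O₂, openConn s b)
  rw [h.1, h'.1, h.2] at key
  exact key

/-- On `{c ↔ all of S}` (`S ≠ ∅`) the attachment events `{o ↔ S}` and `{o ↔ S ∪ {c}}` coincide (inside any event `D`). [folklore] -/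
theorem plus_event_eq (S : Finset (Fin n)) (o c : Fin n) (hS : S.Nonempty) (D : Set (BondConfig (Fin n))) :
    D ∩ ((⋃ s ∈ S, (openConn s o : Set (BondConfig (Fin n)))) ∩ ⋂ s ∈ S, (openConn s c : Set (BondConfig (Fin n)))) =
      D ∩ ((⋃ s ∈ insert c S, (openConn s o : Set (BondConfig (Fin n)))) ∩ ⋂ s ∈ S, (openConn s c : Set (BondConfig (Fin n)))) := by
  ext ω
  simp only [mem_inter_iff, mem_iUnion, mem_iInter, knThm2_mem_openConn, exists_prop, Finset.mem_insert]
  constructor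
  · rintro ⟨hD, ⟨s, hs, hso⟩, hall⟩
    exact ⟨hD, ⟨s, Or.inr hs, hso⟩, hall⟩
  · rintro ⟨hD, ⟨s, hs, hso⟩, hall⟩
    refine ⟨hD, ?_, hall⟩
    rcases hs with rfl | hs
    · obtain ⟨t, ht⟩ := hS
      exact ⟨t, ht, (hall t ht).trans hso⟩
    · exact ⟨s, hs, hso⟩

/-- For `∅ ≠ S ⊆ A` with `A ∖ S ≠ ∅`, `o, c ∉ A`, `o ≠ c`:
`T_S − U_S ≥ (A⁺⁺_S / P⁺_S) · m_S − (A⁻_S / P⁻_S) · m_R`, `A⁺⁺_S = μ(N⁺_S ∩ {o ↔ S ∪ {c}})` — BHK Thm 1.3 for the cluster of `S ∪ {o,c}`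
(any-reach set `S ∪ {c}`, all-reach set `S`) and BHK Thm 1.4 for the clusters of `S ∪ {o}` / `(A∖S) ∪ {c}` (tools = the landed `stub_bhkSets`).
[cite: VandenbergHaggstromKahn2005, Thms. 1.3–1.4 (pp. 6–7)] -/
theorem term_ge3 (w : Sym2 (Fin n) → unitInterval) (A S : Finset (Fin n)) (o c : Fin n) (ho : o ∉ A) (hc : c ∉ A)
    (hoc : o ≠ c) (hSA : S ⊆ A) (hS : S.Nonempty) (hR : (A \ S).Nonempty) :
    (prodBernoulli w).real
        ({ω : BondConfig (Fin n) | ∀ s ∈ insert c (insert o S), ∀ x ∈ A \ S, ¬ (openGraph ω).Reachable s x} ∩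
          ⋃ s ∈ insert c S, (openConn s o : Set (BondConfig (Fin n)))) /
      (prodBernoulli w).real {ω : BondConfig (Fin n) | ∀ s ∈ insert c (insert o S), ∀ x ∈ A \ S, ¬ (openGraph ω).Reachable s x} *
      (prodBernoulli w).real
          ({ω : BondConfig (Fin n) | ∀ s ∈ insert o S, ∀ x ∈ A \ S, ¬ (openGraph ω).Reachable s x} ∩
            ⋂ s ∈ S, (openConn s c : Set (BondConfig (Fin n)))) -
    (prodBernoulli w).real
        ({ω : BondConfig (Fin n) | ∀ s ∈ insert o S, ∀ x ∈ insert c (A \ S), ¬ (openGraph ω).Reachable s x} ∩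
          ⋃ s ∈ S, (openConn s o : Set (BondConfig (Fin n)))) /
      (prodBernoulli w).real {ω : BondConfig (Fin n) | ∀ s ∈ insert o S, ∀ x ∈ insert c (A \ S), ¬ (openGraph ω).Reachable s x} *
      (prodBernoulli w).real
          ({ω : BondConfig (Fin n) | ∀ s ∈ insert o S, ∀ x ∈ A \ S, ¬ (openGraph ω).Reachable s x} ∩
            ⋂ x ∈ A \ S, (openConn x c : Set (BondConfig (Fin n)))) ≤
    (prodBernoulli w).real
        ({ω : BondConfig (Fin n) | ∀ s ∈ insert o S, ∀ x ∈ A \ S, ¬ (openGraph ω).Reachable s x} ∩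
          ((⋃ s ∈ S, (openConn s o : Set (BondConfig (Fin n)))) ∩ ⋂ s ∈ S, (openConn s c : Set (BondConfig (Fin n))))) -
      (prodBernoulli w).real
        ({ω : BondConfig (Fin n) | ∀ s ∈ insert o S, ∀ x ∈ A \ S, ¬ (openGraph ω).Reachable s x} ∩
          ((⋃ s ∈ S, (openConn s o : Set (BondConfig (Fin n)))) ∩
            ⋂ x ∈ A \ S, (openConn x c : Set (BondConfig (Fin n))))) := by
  -- plus step: BHK Thm 1.3 for the cluster of `S ∪ {o, c}`, any-reach set `S ∪ {c}`, all-reach set `S`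
  have h₁ : insert c S ⊆ insert c (insert o S) := Finset.insert_subset_insert c (Finset.subset_insert o S)
  have h₂ : S ⊆ insert c (insert o S) := (Finset.subset_insert o S).trans (Finset.subset_insert c _)
  have hSX : ∀ s ∈ insert c (insert o S), s ∉ (↑(A \ S) : Set (Fin n)) := by
    intro s hs
    rw [Finset.mem_coe, Finset.mem_sdiff]
    rcases Finset.mem_insert.1 hs with rfl | hs
    · exact fun h => hc h.1
    rcases Finset.mem_insert.1 hs with rfl | hsS
    · exact fun h => ho h.1
    · exact fun h => h.2 hsS
  have i1 := bhkOne_two_subsets stub_bhkSets.1 w (insert c (insert o S)) (insert c S) S h₁ h₂ (↑(A \ S) : Set (Fin n)) o c hSX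
  have hset : {ω : BondConfig (Fin n) | ∀ s ∈ insert c (insert o S), ∀ x ∈ (↑(A \ S) : Set (Fin n)),
      ¬ (openGraph ω).Reachable s x} =
      {ω : BondConfig (Fin n) | ∀ s ∈ insert c (insert o S), ∀ x ∈ A \ S, ¬ (openGraph ω).Reachable s x} := by
    ext ω; simp only [mem_setOf_eq, Finset.mem_coe]
  rw [hset] at i1
  have e1 := RKNS2.plus_inter_eq A S o c hS (Set.univ : Set (BondConfig (Fin n)))
  have e1' := RKNS2.plus_inter_eq A S o c hS (⋃ s ∈ S, (openConn s o : Set (BondConfig (Fin n))))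
  simp only [Set.univ_inter] at e1
  have e1'' := plus_event_eq S o c hS
    {ω : BondConfig (Fin n) | ∀ s ∈ insert c (insert o S), ∀ x ∈ A \ S, ¬ (openGraph ω).Reachable s x}
  -- minus step: BHK Thm 1.4 for the clusters of `S ∪ {o}` and `(A ∖ S) ∪ {c}`
  have hdisj : Disjoint (insert o S) (insert c (A \ S)) := by
    rw [Finset.disjoint_left]
    intro s hs hs'
    rcases Finset.mem_insert.1 hs with rfl | hsS
    · rcases Finset.mem_insert.1 hs' with h | h
      · exact hoc h
      · exact ho (Finset.mem_sdiff.1 h).1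
    · rcases Finset.mem_insert.1 hs' with h | h
      · exact hc (h ▸ hSA hsS)
      · exact (Finset.mem_sdiff.1 h).2 hsS
  have i2 := knRef_bhkTwo stub_bhkSets.2 w (insert o S) (insert c (A \ S)) S (A \ S) (Finset.subset_insert o S)
    (Finset.subset_insert c _) o c hdisj
  have e2 := RKNS2.minus_inter_eq A S o c hR (Set.univ : Set (BondConfig (Fin n)))
  have e2' := RKNS2.minus_inter_eq A S o c hR (⋃ s ∈ S, (openConn s o : Set (BondConfig (Fin n))))
  simp only [Set.univ_inter] at e2
  rw [e1, e1', e1'', e2, e2']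
  exact RKNS2.arith_term2
    (measureReal_mono (h₂ := measure_ne_top _ _) inter_subset_left)
    (measureReal_mono (h₂ := measure_ne_top _ _) inter_subset_left)
    measureReal_nonneg measureReal_nonneg i1 i2

/-- **`X ≥ Σ_S [(A⁺⁺_S/P⁺_S) m_S − (A⁻_S/P⁻_S) m_R]`**: the fully-refined `k`-relay Kozma–Nitzan exchange at the designated relay `z`.
[cite: KozmaNitzan2024, Theorem 2 (§3.1, pp. 8–9); VandenbergHaggstromKahn2005, Thms. 1.3–1.4 (pp. 6–7)] -/
theorem X_ge_sum3 (w : Sym2 (Fin n) → unitInterval) (A : Finset (Fin n)) (o c z : Fin n) (ho : o ∉ A) (hc : c ∉ A)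
    (hoc : o ≠ c) (hz : z ∈ A) :
    ∑ S ∈ (A.erase z).powerset.filter (fun S => S.Nonempty),
      ((prodBernoulli w).real
          ({ω : BondConfig (Fin n) | ∀ s ∈ insert c (insert o S), ∀ x ∈ A \ S, ¬ (openGraph ω).Reachable s x} ∩
            ⋃ s ∈ insert c S, (openConn s o : Set (BondConfig (Fin n)))) /
        (prodBernoulli w).real {ω : BondConfig (Fin n) | ∀ s ∈ insert c (insert o S), ∀ x ∈ A \ S, ¬ (openGraph ω).Reachable s x} *
        (prodBernoulli w).real
            ({ω : BondConfig (Fin n) | ∀ s ∈ insert o S, ∀ x ∈ A \ S, ¬ (openGraph ω).Reachable s x} ∩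
              ⋂ s ∈ S, (openConn s c : Set (BondConfig (Fin n)))) -
      (prodBernoulli w).real
          ({ω : BondConfig (Fin n) | ∀ s ∈ insert o S, ∀ x ∈ insert c (A \ S), ¬ (openGraph ω).Reachable s x} ∩
            ⋃ s ∈ S, (openConn s o : Set (BondConfig (Fin n)))) /
        (prodBernoulli w).real {ω : BondConfig (Fin n) | ∀ s ∈ insert o S, ∀ x ∈ insert c (A \ S), ¬ (openGraph ω).Reachable s x} *
        (prodBernoulli w).real
            ({ω : BondConfig (Fin n) | ∀ s ∈ insert o S, ∀ x ∈ A \ S, ¬ (openGraph ω).Reachable s x} ∩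
              ⋂ x ∈ A \ S, (openConn x c : Set (BondConfig (Fin n))))) ≤
    (prodBernoulli w).real ((⋃ a ∈ A, (openConn o a : Set (BondConfig (Fin n)))) ∩ openConn o c) -
      (prodBernoulli w).real ((⋃ a ∈ A, (openConn o a : Set (BondConfig (Fin n)))) ∩ openConn z c) := by
  have h1 := RKNS.pos_ge w A o c z hz
  have h2 := RKNS.neg_le w A o c z ho
  have h3 : ∑ S ∈ (A.erase z).powerset.filter (fun S => S.Nonempty),
      ((prodBernoulli w).real
          ({ω : BondConfig (Fin n) | ∀ s ∈ insert c (insert o S), ∀ x ∈ A \ S, ¬ (openGraph ω).Reachable s x} ∩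
            ⋃ s ∈ insert c S, (openConn s o : Set (BondConfig (Fin n)))) /
        (prodBernoulli w).real {ω : BondConfig (Fin n) | ∀ s ∈ insert c (insert o S), ∀ x ∈ A \ S, ¬ (openGraph ω).Reachable s x} *
        (prodBernoulli w).real
            ({ω : BondConfig (Fin n) | ∀ s ∈ insert o S, ∀ x ∈ A \ S, ¬ (openGraph ω).Reachable s x} ∩
              ⋂ s ∈ S, (openConn s c : Set (BondConfig (Fin n)))) -
      (prodBernoulli w).real
          ({ω : BondConfig (Fin n) | ∀ s ∈ insert o S, ∀ x ∈ insert c (A \ S), ¬ (openGraph ω).Reachable s x} ∩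
            ⋃ s ∈ S, (openConn s o : Set (BondConfig (Fin n)))) /
        (prodBernoulli w).real {ω : BondConfig (Fin n) | ∀ s ∈ insert o S, ∀ x ∈ insert c (A \ S), ¬ (openGraph ω).Reachable s x} *
        (prodBernoulli w).real
            ({ω : BondConfig (Fin n) | ∀ s ∈ insert o S, ∀ x ∈ A \ S, ¬ (openGraph ω).Reachable s x} ∩
              ⋂ x ∈ A \ S, (openConn x c : Set (BondConfig (Fin n))))) ≤
      ∑ S ∈ (A.erase z).powerset.filter (fun S => S.Nonempty),
        ((prodBernoulli w).real
          ({ω : BondConfig (Fin n) | ∀ s ∈ insert o S, ∀ x ∈ A \ S, ¬ (openGraph ω).Reachable s x} ∩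
            ((⋃ s ∈ S, (openConn s o : Set (BondConfig (Fin n)))) ∩ ⋂ s ∈ S, (openConn s c : Set (BondConfig (Fin n))))) -
        (prodBernoulli w).real
          ({ω : BondConfig (Fin n) | ∀ s ∈ insert o S, ∀ x ∈ A \ S, ¬ (openGraph ω).Reachable s x} ∩
            ((⋃ s ∈ S, (openConn s o : Set (BondConfig (Fin n)))) ∩
              ⋂ x ∈ A \ S, (openConn x c : Set (BondConfig (Fin n)))))) := by
    refine Finset.sum_le_sum fun S hSm => ?_
    rw [Finset.mem_filter, Finset.mem_powerset] at hSm
    have hSA : S ⊆ A := hSm.1.trans (Finset.erase_subset z A)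
    have hR : (A \ S).Nonempty := ⟨z, Finset.mem_sdiff.2 ⟨hz, fun hzS => by simpa using hSm.1 hzS⟩⟩
    exact term_ge3 w A S o c ho hc hoc hSA hSm.2 hR
  rw [Finset.sum_sub_distrib] at h3
  rw [Finset.sum_sub_distrib] at h3
  rw [Finset.sum_sub_distrib]
  linarith

end RKNS3

open RKNS3

/-- **`(RKNS³)_k ⟹ EG_k` at the designated relay.**  For `o, c ∉ A`, `o ≠ c`, `z ∈ A`: if the fully-refined residual row
`Σ_{∅≠S⊆A∖z} [(A⁺⁺_S/P⁺_S)·m_S − (A⁻_S/P⁻_S)·m_R] + μ(o↮A, z↮c) ≥ 0` holds (notation in the module docstring), then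
`μ({o↔A} ∖ {o↔c}) ≤ μ(z ↮ c)`. [this file] -/
theorem eventGluing_of_rkns3_at (w : Sym2 (Fin n) → unitInterval) (A : Finset (Fin n)) (o c z : Fin n)
    (ho : o ∉ A) (hc : c ∉ A) (hoc : o ≠ c) (hz : z ∈ A)
    (hR : 0 ≤ ∑ S ∈ (A.erase z).powerset.filter (fun S => S.Nonempty),
      ((prodBernoulli w).real
          ({ω : BondConfig (Fin n) | ∀ s ∈ insert c (insert o S), ∀ x ∈ A \ S, ¬ (openGraph ω).Reachable s x} ∩
            ⋃ s ∈ insert c S, (openConn s o : Set (BondConfig (Fin n)))) /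
        (prodBernoulli w).real {ω : BondConfig (Fin n) | ∀ s ∈ insert c (insert o S), ∀ x ∈ A \ S, ¬ (openGraph ω).Reachable s x} *
        (prodBernoulli w).real
            ({ω : BondConfig (Fin n) | ∀ s ∈ insert o S, ∀ x ∈ A \ S, ¬ (openGraph ω).Reachable s x} ∩
              ⋂ s ∈ S, (openConn s c : Set (BondConfig (Fin n)))) -
      (prodBernoulli w).real
          ({ω : BondConfig (Fin n) | ∀ s ∈ insert o S, ∀ x ∈ insert c (A \ S), ¬ (openGraph ω).Reachable s x} ∩
            ⋃ s ∈ S, (openConn s o : Set (BondConfig (Fin n)))) /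
        (prodBernoulli w).real {ω : BondConfig (Fin n) | ∀ s ∈ insert o S, ∀ x ∈ insert c (A \ S), ¬ (openGraph ω).Reachable s x} *
        (prodBernoulli w).real
            ({ω : BondConfig (Fin n) | ∀ s ∈ insert o S, ∀ x ∈ A \ S, ¬ (openGraph ω).Reachable s x} ∩
              ⋂ x ∈ A \ S, (openConn x c : Set (BondConfig (Fin n))))) +
      (prodBernoulli w).real ((⋃ a ∈ A, (openConn o a : Set (BondConfig (Fin n))))ᶜ ∩ (openConn z c)ᶜ)) :
    (prodBernoulli w).real ((⋃ a ∈ A, (openConn o a : Set (BondConfig (Fin n)))) \ openConn o c) ≤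
      (prodBernoulli w).real ((openConn z c)ᶜ : Set (BondConfig (Fin n))) := by
  have hX := X_ge_sum3 w A o c z ho hc hoc hz
  have hm : ∀ s : Set (BondConfig (Fin n)), MeasurableSet s := fun _ => MeasurableSet.of_discrete
  have h1 := measureReal_inter_add_sdiff (μ := prodBernoulli w)
    (s := ⋃ a ∈ A, (openConn o a : Set (BondConfig (Fin n)))) (hm (openConn o c)) (h := measure_ne_top _ _)
  have h2 := measureReal_inter_add_sdiff (μ := prodBernoulli w)
    (s := ⋃ a ∈ A, (openConn o a : Set (BondConfig (Fin n)))) (hm (openConn z c)) (h := measure_ne_top _ _)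
  have h3 := measureReal_inter_add_sdiff (μ := prodBernoulli w)
    (s := ((openConn z c)ᶜ : Set (BondConfig (Fin n)))) (hm (⋃ a ∈ A, (openConn o a : Set (BondConfig (Fin n)))))
    (h := measure_ne_top _ _)
  have e1 : ((openConn z c)ᶜ : Set (BondConfig (Fin n))) ∩ (⋃ a ∈ A, (openConn o a : Set (BondConfig (Fin n)))) =
      (⋃ a ∈ A, (openConn o a : Set (BondConfig (Fin n)))) \ openConn z c := by
    ext ω; simp only [mem_inter_iff, mem_compl_iff, mem_sdiff]; tauto
  have e2 : ((openConn z c)ᶜ : Set (BondConfig (Fin n))) \ (⋃ a ∈ A, (openConn o a : Set (BondConfig (Fin n)))) =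
      (⋃ a ∈ A, (openConn o a : Set (BondConfig (Fin n))))ᶜ ∩ (openConn z c)ᶜ := by
    ext ω; simp only [mem_inter_iff, mem_compl_iff, mem_sdiff]; tauto
  rw [e1, e2] at h3
  linarith

/-- **`(RKNS³)` at a worst relay on every finite weighted graph ⟹ sharp event gluing for every `k` ⟹ `NoHeavyLowerTail`**
(stmt-CriticalPhenomena-4575), through the landed chain `noHeavyLowerTail_of_eventGluing`.  Termwise `A⁺⁺/P⁺ ≥ A⁺/P⁺ ≥ A/P` and
`A⁻/P⁻ ≤ A/P` (BHK), so this hypothesis is implied by those of `noHeavyLowerTail_of_rkns2` and `noHeavyLowerTail_of_rkns`. [this file] -/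
theorem noHeavyLowerTail_of_rkns3
    (hR : ∀ (n : ℕ) (w : Sym2 (Fin n) → unitInterval) (A : Finset (Fin n)) (o c z : Fin n),
      o ∉ A → c ∉ A → o ≠ c → z ∈ A →
      (∀ a ∈ A, (prodBernoulli w).real (openConn z c) ≤ (prodBernoulli w).real (openConn a c)) →
      0 ≤ ∑ S ∈ (A.erase z).powerset.filter (fun S => S.Nonempty),
        ((prodBernoulli w).real
            ({ω : BondConfig (Fin n) | ∀ s ∈ insert c (insert o S), ∀ x ∈ A \ S, ¬ (openGraph ω).Reachable s x} ∩
              ⋃ s ∈ insert c S, (openConn s o : Set (BondConfig (Fin n)))) /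
          (prodBernoulli w).real {ω : BondConfig (Fin n) | ∀ s ∈ insert c (insert o S), ∀ x ∈ A \ S, ¬ (openGraph ω).Reachable s x} *
          (prodBernoulli w).real
              ({ω : BondConfig (Fin n) | ∀ s ∈ insert o S, ∀ x ∈ A \ S, ¬ (openGraph ω).Reachable s x} ∩
                ⋂ s ∈ S, (openConn s c : Set (BondConfig (Fin n)))) -
        (prodBernoulli w).real
            ({ω : BondConfig (Fin n) | ∀ s ∈ insert o S, ∀ x ∈ insert c (A \ S), ¬ (openGraph ω).Reachable s x} ∩
              ⋃ s ∈ S, (openConn s o : Set (BondConfig (Fin n)))) /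
          (prodBernoulli w).real {ω : BondConfig (Fin n) | ∀ s ∈ insert o S, ∀ x ∈ insert c (A \ S), ¬ (openGraph ω).Reachable s x} *
          (prodBernoulli w).real
              ({ω : BondConfig (Fin n) | ∀ s ∈ insert o S, ∀ x ∈ A \ S, ¬ (openGraph ω).Reachable s x} ∩
                ⋂ x ∈ A \ S, (openConn x c : Set (BondConfig (Fin n))))) +
        (prodBernoulli w).real ((⋃ a ∈ A, (openConn o a : Set (BondConfig (Fin n))))ᶜ ∩ (openConn z c)ᶜ)) :
    Summit.CriticalPhenomena.PercolationContinuityZ3.Theses.PercNearOneGluing.NoHeavyLowerTail := by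
  apply noHeavyLowerTail_of_eventGluing
  intro n w A o c s hs hcut
  by_cases hoc : o = c
  · subst hoc
    have hempty : ((openConn o o : Set (BondConfig (Fin n)))ᶜ ∩ ⋃ a ∈ A, openConn o a) = ∅ := by
      ext ω
      simp only [mem_inter_iff, mem_compl_iff, mem_empty_iff_false, iff_false, not_and]
      intro h; exact absurd (show ω ∈ (openConn o o : Set (BondConfig (Fin _))) from SimpleGraph.Reachable.refl o) h
    rw [hempty, measureReal_empty]; exact hs
  by_cases hoA : o ∈ A
  · calc (prodBernoulli w).real ((openConn o c : Set (BondConfig (Fin n)))ᶜ ∩ ⋃ a ∈ A, openConn o a)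
        ≤ (prodBernoulli w).real ((openConn o c : Set (BondConfig (Fin n)))ᶜ) :=
          measureReal_mono (h₂ := measure_ne_top _ _) inter_subset_left
      _ ≤ s := hcut o hoA
  set A' : Finset (Fin n) := A.erase c with hA'
  have hsub : ((openConn o c : Set (BondConfig (Fin n)))ᶜ ∩ ⋃ a ∈ A, openConn o a) ⊆
      (⋃ a ∈ A', (openConn o a : Set (BondConfig (Fin n)))) \ openConn o c := by
    rintro ω ⟨hoc', hU⟩
    simp only [mem_iUnion, exists_prop] at hU
    obtain ⟨a, haA, hoa⟩ := hU
    refine ⟨?_, hoc'⟩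
    simp only [mem_iUnion, exists_prop]
    refine ⟨a, ?_, hoa⟩
    rw [hA', Finset.mem_erase]
    refine ⟨?_, haA⟩
    rintro rfl; exact hoc' hoa
  refine (measureReal_mono (h₂ := measure_ne_top _ _) hsub).trans ?_
  by_cases hne : A'.Nonempty
  swap
  · rw [Finset.not_nonempty_iff_eq_empty] at hne
    have hempty : ((⋃ a ∈ A', (openConn o a : Set (BondConfig (Fin n)))) \ openConn o c) = ∅ := by
      rw [hne]; simp
    rw [hempty, measureReal_empty]; exact hs
  obtain ⟨z, hzA', hzmin⟩ := Finset.exists_min_image A' (fun a => (prodBernoulli w).real (openConn a c)) hne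
  have hoA' : o ∉ A' := fun h => hoA (Finset.mem_of_mem_erase h)
  have hcA' : c ∉ A' := by rw [hA']; exact Finset.notMem_erase c A
  have hEG := eventGluing_of_rkns3_at w A' o c z hoA' hcA' hoc hzA' (hR n w A' o c z hoA' hcA' hoc hzA' hzmin)
  exact hEG.trans (hcut z (Finset.mem_of_mem_erase hzA'))

end

end Summit.CriticalPhenomena.PercolationContinuityZ3.Theorems
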